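import Literature.NumberTheory.EllipticCurves.LevelLoweringPrimesCount
import HarnessLib

/-!
# Pasten 2024, Cor 16.6 (counting level-lowering primes) from Thm 1.12 (proofs)

Topic `Literature/NumberTheory/EllipticCurves`; companion PROOF file (theorems only, no new statement;
D-0026) of `LevelLoweringPrimesCount.lean` (H. Pasten, *Shimura curves and the abc conjecture*,
J. Number Theory 254 (2024) = arXiv:1705.09251, §16.3 [`PastenShimura2024`]). It reduces the named
fact `PastenShimura2024_cor_16_6` (`#L(E) < (11/2 + ε) log N / log log N + O_ε(1)` for semistable
`E/ℚ`) to the named fact `DiophantineGeometry.pastenShimura2024_thm_1_12`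
(`∏_{p ∣ N} v_p(Δ_E) < K_ε N^{11/2+ε}`, Pasten's Thm 1.12 = Thm 16.5 (ii) at `D = N`), following the
printed proof: `∏_{ℓ ∈ L} ℓ ≤ ∏_{p∣N} v_p(Δ_E)` (PROVED in the statements file,
`prod_levelLoweringPrimes_le`) and a count of distinct primes with bounded product. The printed
appeal to the prime number theorem is replaced by the elementary bound
`#L ≤ y + (Σ_{ℓ∈L} log ℓ)/log y` (`y > 1`) at `y = (log N)^{1−β(ε)}`, which loses only an `ε` in the
leading constant — enough for the statement as printed.

## References

* [PastenShimura2024] H. Pasten, J. Number Theory 254 (2024) = arXiv:1705.09251: Thm 1.12, Thm 1.13,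
  §16.3 (Thm 16.5, Cor 16.6; arXiv p. 50).
-/

noncomputable section

open WeierstrassCurve UniqueFactorizationMonoid

namespace Literature.NumberTheory.EllipticCurves

namespace Pasten2024

/-- Elementary sieve step: a finite set of integers `≥ 1` has at most `y + (Σ log ℓ)/log y`
elements for every real `y > 1` (those `≤ y` are at most `y`, each other one contributes
`≥ log y` to the sum). [folklore] -/
private theorem card_le_add_sum_log_div {L : Finset ℕ} (hL : ∀ ℓ ∈ L, 1 ≤ ℓ) {y : ℝ} (hy : 1 < y) :
    (L.card : ℝ) ≤ y + (∑ ℓ ∈ L, Real.log ℓ) / Real.log y := by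
  classical
  have hlogy : 0 < Real.log y := Real.log_pos hy
  set L₁ : Finset ℕ := L.filter (fun ℓ : ℕ => (ℓ : ℝ) ≤ y) with hL₁
  set L₂ : Finset ℕ := L.filter (fun ℓ : ℕ => ¬ (ℓ : ℝ) ≤ y) with hL₂
  have hcard : L₁.card + L₂.card = L.card := by
    rw [hL₁, hL₂]; exact Finset.card_filter_add_card_filter_not (fun ℓ : ℕ => (ℓ : ℝ) ≤ y)
  -- `#L₁ ≤ ⌊y⌋ ≤ y`
  have h1 : (L₁.card : ℝ) ≤ y := by
    have hsub : L₁ ⊆ Finset.Icc 1 ⌊y⌋₊ := by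
      intro ℓ hℓ
      rw [Finset.mem_filter] at hℓ
      exact Finset.mem_Icc.mpr ⟨hL ℓ hℓ.1, Nat.le_floor hℓ.2⟩
    have := Finset.card_le_card hsub
    rw [Nat.card_Icc] at this
    calc (L₁.card : ℝ) ≤ ((⌊y⌋₊ + 1 - 1 : ℕ) : ℝ) := by exact_mod_cast this
      _ = ⌊y⌋₊ := by simp
      _ ≤ y := Nat.floor_le (by linarith)
  -- `#L₂ · log y ≤ Σ_{L₂} log ℓ ≤ Σ_L log ℓ`
  have h2 : (L₂.card : ℝ) * Real.log y ≤ ∑ ℓ ∈ L, Real.log ℓ := by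
    have hle : (L₂.card : ℝ) * Real.log y ≤ ∑ ℓ ∈ L₂, Real.log ℓ := by
      have := Finset.card_nsmul_le_sum L₂ (fun ℓ => Real.log (ℓ : ℝ)) (Real.log y)
        (fun ℓ hℓ => by
          rw [Finset.mem_filter, not_le] at hℓ
          exact Real.log_le_log (by linarith) hℓ.2.le)
      rwa [nsmul_eq_mul] at this
    refine hle.trans (Finset.sum_le_sum_of_subset_of_nonneg (Finset.filter_subset _ _) ?_)
    intro ℓ hℓ _
    exact Real.log_nonneg (by exact_mod_cast hL ℓ hℓ)
  have h2' : (L₂.card : ℝ) ≤ (∑ ℓ ∈ L, Real.log ℓ) / Real.log y := by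
    rw [le_div_iff₀ hlogy]; exact h2
  have hcard' : (L.card : ℝ) = L₁.card + L₂.card := by exact_mod_cast hcard.symm
  rw [hcard']
  linarith

/-- `log(∏ ℓ) = Σ log ℓ` for a finite set of positive naturals. [folklore] -/
private theorem log_prod_eq_sum_log {L : Finset ℕ} (hL : ∀ ℓ ∈ L, 1 ≤ ℓ) :
    Real.log ((∏ ℓ ∈ L, ℓ : ℕ) : ℝ) = ∑ ℓ ∈ L, Real.log ℓ := by
  rw [Nat.cast_prod, Real.log_prod]
  intro ℓ hℓ
  have : 0 < ℓ := hL ℓ hℓ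
  exact_mod_cast this.ne'

/-- `x^θ ≤ (ε/4)·x/log x + T` for `x ≥ 1` with `log x > 0`, `θ = 1 − β`, `0 < β`,
`T = (8/(εβ))^{2/β}`. [folklore] -/
private theorem rpow_le_eps_mul_div_log_add {x ε β : ℝ} (hx : 1 ≤ x) (hlx : 0 < Real.log x)
    (hε : 0 < ε) (hβ : 0 < β) :
    x ^ (1 - β) ≤ ε / 4 * x / Real.log x + (8 / (ε * β)) ^ (2 / β) := by
  have hx0 : 0 < x := by linarith
  have hT : 0 ≤ (8 / (ε * β)) ^ (2 / β) := Real.rpow_nonneg (by positivity) _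
  by_cases h : 8 / (ε * β) ≤ x ^ (β / 2)
  · -- large `x`: `log x ≤ (2/β) x^{β/2} ≤ (ε/4) x^β`, so `x^{1-β} ≤ (ε/4) x / log x`
    have hlog : Real.log x ≤ x ^ (β / 2) / (β / 2) := Real.log_le_rpow_div hx0.le (by positivity)
    have hxb2 : 0 < x ^ (β / 2) := Real.rpow_pos_of_pos hx0 _
    have hstep : Real.log x ≤ ε / 4 * x ^ β := by
      have h1 : x ^ (β / 2) / (β / 2) = 2 / β * x ^ (β / 2) := by field_simp
      have h2 : x ^ β = x ^ (β / 2) * x ^ (β / 2) := by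
        rw [← Real.rpow_add hx0]; ring_nf
      rw [h1] at hlog
      rw [h2]
      have h3 : 2 / β * x ^ (β / 2) ≤ ε / 4 * (x ^ (β / 2) * x ^ (β / 2)) := by
        have h4 : 2 / β ≤ ε / 4 * x ^ (β / 2) := by
          have := mul_le_mul_of_nonneg_left h (by positivity : (0 : ℝ) ≤ ε * β / 8)
          have h5 : ε * β / 8 * (8 / (ε * β)) = 1 := by field_simp
          rw [h5] at this
          calc 2 / β = 2 / β * 1 := by ring
            _ ≤ 2 / β * (ε * β / 8 * x ^ (β / 2)) := by gcongr
            _ = ε / 4 * x ^ (β / 2) := by field_simp; ring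
        calc 2 / β * x ^ (β / 2) ≤ (ε / 4 * x ^ (β / 2)) * x ^ (β / 2) :=
              mul_le_mul_of_nonneg_right h4 hxb2.le
          _ = ε / 4 * (x ^ (β / 2) * x ^ (β / 2)) := by ring
      exact hlog.trans h3
    have hmain : x ^ (1 - β) ≤ ε / 4 * x / Real.log x := by
      rw [le_div_iff₀ hlx]
      have h6 : x ^ (1 - β) * Real.log x ≤ x ^ (1 - β) * (ε / 4 * x ^ β) :=
        mul_le_mul_of_nonneg_left hstep (Real.rpow_nonneg hx0.le _)
      have h7 : x ^ (1 - β) * x ^ β = x := by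
        rw [← Real.rpow_add hx0]; simp
      calc x ^ (1 - β) * Real.log x ≤ x ^ (1 - β) * (ε / 4 * x ^ β) := h6
        _ = ε / 4 * (x ^ (1 - β) * x ^ β) := by ring
        _ = ε / 4 * x := by rw [h7]
    linarith
  · -- small `x`: `x < T`, and `x^{1-β} ≤ x`
    rw [not_le] at h
    have hxT : x < (8 / (ε * β)) ^ (2 / β) := by
      have hx' : x = (x ^ (β / 2)) ^ (2 / β) := by
        rw [← Real.rpow_mul hx0.le]
        have : β / 2 * (2 / β) = 1 := by field_simp
        rw [this, Real.rpow_one]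
      rw [hx']
      exact Real.rpow_lt_rpow (Real.rpow_nonneg hx0.le _) h (by positivity)
    have hxθ : x ^ (1 - β) ≤ x := by
      calc x ^ (1 - β) ≤ x ^ (1 : ℝ) := Real.rpow_le_rpow_of_exponent_le hx (by linarith)
        _ = x := Real.rpow_one x
    have hpos : 0 ≤ ε / 4 * x / Real.log x := by positivity
    linarith


/-- `log log N ≥ 1` for `N ≥ 16`. [folklore] -/
private theorem one_le_log_log {x : ℝ} (hx : 16 ≤ x) : 1 ≤ Real.log (Real.log x) := by
  have h2 := Real.log_two_gt_d9
  have he := Real.exp_one_lt_d9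
  have h16 : Real.log 16 = 4 * Real.log 2 := by
    rw [show (16 : ℝ) = 2 ^ 4 by norm_num, Real.log_pow]; norm_num
  have hlog : Real.exp 1 ≤ Real.log x := by
    have : Real.log 16 ≤ Real.log x := Real.log_le_log (by norm_num) hx
    linarith
  calc (1 : ℝ) = Real.log (Real.exp 1) := (Real.log_exp 1).symm
    _ ≤ Real.log (Real.log x) := Real.log_le_log (Real.exp_pos 1) hlog

/-- The quantity `log N / log log N` of Cor 16.6 is `≥ −3` for every natural `N` (it is `0` for
`N ≤ 1` by the junk value `log 0 = 0`, negative only at `N = 2`, positive for `N ≥ 3`). [folklore] -/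
private theorem neg_three_le_log_div_log_log (N : ℕ) : -3 ≤ Real.log N / Real.log (Real.log N) := by
  rcases Nat.lt_or_ge N 3 with h | h
  · interval_cases N
    · simp
    · simp
    · have h2 := Real.log_two_lt_d9
      have h2' := Real.log_two_gt_d9
      have hneg : Real.log (Real.log 2) < 0 := Real.log_neg (by linarith) (by linarith)
      have hle : Real.log (Real.log 2) ≤ Real.log 2 - 1 := Real.log_le_sub_one_of_pos (by linarith)
      rw [Nat.cast_ofNat, le_div_iff_of_neg hneg]
      linarith
  · have h3 : (3 : ℝ) ≤ N := by exact_mod_cast h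
    have he := Real.exp_one_lt_d9
    have hlog : 1 < Real.log N := by
      rw [← Real.log_exp 1]
      exact Real.log_lt_log (Real.exp_pos 1) (by linarith)
    have : 0 < Real.log N / Real.log (Real.log N) := div_pos (by linarith) (Real.log_pos hlog)
    linarith

end Pasten2024

open Pasten2024 DiophantineGeometry in
/-- **Pasten 2024, Cor 16.6 from Thm 1.12** (PROVED reduction; the printed proof, §16.3 arXiv
p. 50: "the largest value would be achieved if the exponents `v_p(Δ_E)` for `p ∣ N` were distinct
primes … the prime number theorem and Theorem 16.5 give the result (Theorem 16.5 gives a bound for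
`K = log ∏ v_p(Δ_E)`)"). Here Thm 16.5 enters through its corollary Thm 1.12
(`pastenShimura2024_thm_1_12`: `∏_{p∣N} v_p(Δ_E) < K_ε N^{11/2+ε}` for semistable `E`), and the prime
number theorem is replaced by the elementary sieve `#L ≤ y + log(∏L)/log y` at `y = (log N)^{1−β}`,
`β = β(ε) > 0`, which suffices for the stated `(11/2 + ε) log N / log log N + O_ε(1)`.
[cite: PastenShimura2024, Cor. 16.6 (proof, §16.3, arXiv p. 50) with Thm 1.12] -/
theorem PastenShimura2024_cor_16_6_of_thm_1_12 (h : DiophantineGeometry.pastenShimura2024_thm_1_12) :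
    PastenShimura2024_cor_16_6 := by
  intro ε hε
  obtain ⟨K, hK0, hK⟩ := h (ε / 4) (by positivity)
  have ha0 : (0 : ℝ) < 11 / 2 + ε / 4 := by positivity
  set β : ℝ := (ε / 4) / (11 / 2 + ε / 4 + ε / 4) with hβ
  have hβ0 : 0 < β := by positivity
  have hβ1 : β < 1 := by rw [hβ, div_lt_one (by positivity)]; linarith
  have hθ : 1 - β = (11 / 2 + ε / 4) / (11 / 2 + ε / 4 + ε / 4) := by rw [hβ]; field_simp; ring
  have hθ0 : 0 < 1 - β := by linarith
  have haθ : (11 / 2 + ε / 4) / (1 - β) = 11 / 2 + ε / 4 + ε / 4 := by rw [hθ]; field_simp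
  set T : ℝ := (8 / (ε * β)) ^ (2 / β) with hT
  have hT0 : 0 ≤ T := Real.rpow_nonneg (by positivity) _
  set C₁ : ℝ := |Real.log K| / (1 - β) with hC₁
  have hC₁0 : 0 ≤ C₁ := by positivity
  have hl2 := Real.log_two_gt_d9
  have hl16 : 0 ≤ Real.log 16 := Real.log_nonneg (by norm_num)
  set C₄ : ℝ := 2 + (|Real.log K| + (11 / 2 + ε / 4) * Real.log 16) / Real.log 2 with hC₄
  have hC₄2 : 2 ≤ C₄ := by
    have : 0 ≤ (|Real.log K| + (11 / 2 + ε / 4) * Real.log 16) / Real.log 2 := by positivity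
    linarith
  refine ⟨C₁ + T + C₄ + 3 * (11 / 2 + ε) + 1, fun W _ hsq => ?_⟩
  -- the data of the curve
  have hNpos : 0 < W.conductorNorm ℤ := conductorNorm_pos_holds W
  have hV := hK W hsq
  have hΛV := W.prod_levelLoweringPrimes_le
  have hprimes : ∀ ℓ ∈ W.levelLoweringPrimes, 1 ≤ ℓ :=
    fun ℓ hℓ => (W.prime_of_mem_levelLoweringPrimes hℓ).one_lt.le
  have hΛ1 : 1 ≤ ∏ ℓ ∈ W.levelLoweringPrimes, ℓ :=
    Finset.one_le_prod' fun ℓ hℓ => hprimes ℓ hℓ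
  have hN1 : (1 : ℝ) ≤ ((W.conductorNorm ℤ : ℕ) : ℝ) := by exact_mod_cast hNpos
  have hX := neg_three_le_log_div_log_log (W.conductorNorm ℤ)
  have hΛ1' : (1 : ℝ) ≤ ((∏ ℓ ∈ W.levelLoweringPrimes, ℓ : ℕ) : ℝ) := by exact_mod_cast hΛ1
  have hΛV' : ((∏ ℓ ∈ W.levelLoweringPrimes, ℓ : ℕ) : ℝ) ≤
      ((∏ p ∈ (W.conductorNorm ℤ).primeFactors,
        (W.minimalDiscriminantNorm ℤ).factorization p : ℕ) : ℝ) := by exact_mod_cast hΛV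
  set N : ℝ := ((W.conductorNorm ℤ : ℕ) : ℝ) with hNdef
  -- `Σ log ℓ = log Λ ≤ log V < log K + a log N`
  have hsum : ∑ ℓ ∈ W.levelLoweringPrimes, Real.log ℓ ≤
      |Real.log K| + (11 / 2 + ε / 4) * Real.log N := by
    rw [← log_prod_eq_sum_log hprimes]
    have h1 := Real.log_le_log (by linarith) hΛV'
    have h2 := Real.log_lt_log (by linarith) hV
    rw [Real.log_mul hK0.ne' (by positivity), Real.log_rpow (by linarith)] at h2
    have h3 : Real.log K ≤ |Real.log K| := le_abs_self _
    linarith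
  have hlogN0 : 0 ≤ Real.log N := Real.log_nonneg hN1
  by_cases h16 : 16 ≤ W.conductorNorm ℤ
  · -- large conductor
    have h16' : (16 : ℝ) ≤ N := by rw [hNdef]; exact_mod_cast h16
    have hlx : 1 ≤ Real.log (Real.log N) := one_le_log_log h16'
    have hx1 : 1 < Real.log N := by
      by_contra hcon
      rw [not_lt] at hcon
      have : Real.log (Real.log N) ≤ 0 := Real.log_nonpos hlogN0 hcon
      linarith
    have hx0 : 0 < Real.log N := by linarith
    have hlx0 : 0 < Real.log (Real.log N) := by linarith
    set x : ℝ := Real.log N with hxdef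
    set lx : ℝ := Real.log x with hlxdef
    -- `y = x^{1-β} > 1`, `log y = (1-β) log x`
    have hy : 1 < x ^ (1 - β) := Real.one_lt_rpow hx1 hθ0
    have hlogy : Real.log (x ^ (1 - β)) = (1 - β) * lx := Real.log_rpow hx0 _
    have hk := card_le_add_sum_log_div hprimes hy
    rw [hlogy] at hk
    have hden : 0 < (1 - β) * lx := mul_pos hθ0 hlx0
    -- the quotient
    have hq : (∑ ℓ ∈ W.levelLoweringPrimes, Real.log ℓ) / ((1 - β) * lx) ≤
        C₁ + (11 / 2 + ε / 4 + ε / 4) * (x / lx) := by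
      have h1 : (∑ ℓ ∈ W.levelLoweringPrimes, Real.log ℓ) / ((1 - β) * lx) ≤
          (|Real.log K| + (11 / 2 + ε / 4) * x) / ((1 - β) * lx) :=
        div_le_div_of_nonneg_right hsum hden.le
      have h2 : (|Real.log K| + (11 / 2 + ε / 4) * x) / ((1 - β) * lx) =
          |Real.log K| / ((1 - β) * lx) + (11 / 2 + ε / 4) / (1 - β) * (x / lx) := by
        field_simp
      have h1lx : (1 - β) ≤ (1 - β) * lx := by nlinarith
      have h3 : |Real.log K| / ((1 - β) * lx) ≤ C₁ := by
        rw [hC₁]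
        exact div_le_div_of_nonneg_left (abs_nonneg _) hθ0 h1lx
      rw [h2, haθ] at h1
      linarith
    have hyb := rpow_le_eps_mul_div_log_add hx1.le hlx0 hε hβ0
    have hXnn : 0 ≤ x / lx := div_nonneg hx0.le hlx0.le
    have h5 : ε / 4 * x / lx = ε / 4 * (x / lx) := by ring
    rw [h5] at hyb
    have hεX : 0 ≤ ε * (x / lx) := by positivity
    have hk' : (W.levelLoweringPrimes.card : ℝ) ≤ (11 / 2 + ε) * (x / lx) + C₁ + T := by
      linarith
    rw [mul_div_assoc]
    linarith
  · -- small conductor: `k ≤ C₄`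
    rw [not_le] at h16
    have h16' : N ≤ 16 := by rw [hNdef]; exact_mod_cast h16.le
    have hk := card_le_add_sum_log_div hprimes (y := 2) (by norm_num)
    have hlogN : Real.log N ≤ Real.log 16 := Real.log_le_log (by linarith) h16'
    have hmul : (11 / 2 + ε / 4) * Real.log N ≤ (11 / 2 + ε / 4) * Real.log 16 :=
      mul_le_mul_of_nonneg_left hlogN ha0.le
    have hq : (∑ ℓ ∈ W.levelLoweringPrimes, Real.log ℓ) / Real.log 2 ≤
        (|Real.log K| + (11 / 2 + ε / 4) * Real.log 16) / Real.log 2 :=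
      div_le_div_of_nonneg_right (by linarith) (by linarith)
    have hk' : (W.levelLoweringPrimes.card : ℝ) ≤ C₄ := by rw [hC₄]; linarith
    have hε' : (0 : ℝ) ≤ 11 / 2 + ε := by positivity
    have hlow : (11 / 2 + ε) * (-3) ≤ (11 / 2 + ε) * (Real.log N / Real.log (Real.log N)) :=
      mul_le_mul_of_nonneg_left hX hε'
    rw [mul_div_assoc]
    linarith

end Literature.NumberTheory.EllipticCurves

end
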